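import Literature.Topology.FourManifolds.SeamTube
import Literature.Geometry.Manifold.CompactSupportFlow
import HarnessLib

/-!
# Seam functions and seam tubes for gluings with non-compact pieces (compact seam)

Topic `Literature/Topology/FourManifolds` (infrastructure for the uniqueness of cobordism
attachments `W ∪_ψ X`, Milnor, *Lectures on the h-cobordism theorem* (1965), Thm. 1.4,
uniqueness half, used by the fact seat of
`Literature.Barriers.SmoothPoincare4.akbulutRuberman2016_relativelyExotic`).  Everything here
is PROVED; no definitions, no named facts.

The tree's seam height functions (`BoundaryGluingData.exists_seamFunction`, `SeamFunction.lean`)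
and seam tubes (`BoundaryGluingData.nonempty_seamTube`, `SeamTube.lean`) of a gluing datum
`G : BoundaryGluingData bM bN φ P` are stated for COMPACT Hausdorff pieces `M`, `N` (so that `P`
is compact: partitions of unity on `P`, and the global flow of a vector field on a compact
manifold).  To compare two attachments `W ∪_ψ X` of a cobordism `X` — where the glued manifold
has the far end `N` of `X` as boundary — one works in the INTERIOR of the attachment, glued from
`W` and the non-compact piece `X - N`; this file provides the same two results when only the
seam is compact:

* `BoundaryGluingData.exists_seamFunction_offCompact` — for `P` Hausdorff, σ-compact and locally
  compact and `∂M` compact, a `C^∞` seam height function `f : P → ℝ` (zero exactly on the seam,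
  positive exactly on `jA (Int M)`, negative exactly on `jB (Int N)`, regular along the seam)
  which moreover takes only the values `±1` off a compact set: the flat charts of the
  construction are cut down to a relatively compact neighbourhood `Ω` of the seam, so that off
  `range jA ∪ Ω̄`... more precisely off `Ω̄` and off the seam strata the partition of unity only
  sees the constants `±1`.
* `BoundaryGluingData.exists_regular_compact_band` — hence a band `f⁻¹[-δ, δ]` which is compact
  and free of critical points.
* `BoundaryGluingData.nonempty_seamTube_of_sigmaCompact` — **seam tubes exist** in this
  generality: the unit-speed field across the band (`exists_contMDiffSection_mlineDeriv_eq_one_on`)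
  is cut off to compact support, hence complete
  (`Literature.Geometry.Manifold.exists_contMDiff_globalFlow_of_eq_zero_off_isCompact`,
  `CompactSupportFlow.lean`), and its global flow from the seam is the tube, exactly as in
  `SeamTube.lean` (Milnor (1965), proof of Thm. 3.4; Hirsch (1976), Ch. 8 §1, proof of Thm. 1.9).

## References

* M. W. Hirsch, *Differential Topology*, GTM 33 (1976), Ch. 8 §1, Thm. 1.9. [HirschDT1976]
* J. Milnor, *Lectures on the h-cobordism theorem*, Princeton (1965), §1 Thm. 1.4, §3 proof of
  Thm. 3.4. [MilnorHCobordism1965]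
* J. M. Lee, *Introduction to Smooth Manifolds*, 2nd ed. (2012), Thm. 9.16. [LeeSmoothManifolds2013]
-/

open scoped Manifold ContDiff Topology
open Set Function Metric Filter Topology

noncomputable section

namespace Literature.Topology.FourManifolds

universe u w

/-- Local notation: `𝔼 n` is the model Euclidean space `EuclideanSpace ℝ (Fin n)`. -/
local notation "𝔼 " n:arg => EuclideanSpace ℝ (Fin n)
/-- Local notation: `ℍ n` is the closed half space `EuclideanHalfSpace n`. -/
local notation "ℍ " n:arg => EuclideanHalfSpace n

variable {n : ℕ} {M N : Type u} [TopologicalSpace M] [ChartedSpace (ℍ (n + 1)) M]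
  [TopologicalSpace N] [ChartedSpace (ℍ (n + 1)) N]
  {bM : BoundaryData (𝓡∂ (n + 1)) M (𝓡 n)} {bN : BoundaryData (𝓡∂ (n + 1)) N (𝓡 n)}
  {φ : bM.carrier ≃ bN.carrier}
  {P : Type w} [TopologicalSpace P] [ChartedSpace (𝔼 (n + 1)) P]
  (G : BoundaryGluingData bM bN φ P)
  [IsManifold (𝓡∂ (n + 1)) ∞ M] [IsManifold (𝓡∂ (n + 1)) ∞ N] [IsManifold (𝓡 (n + 1)) ∞ P]
  [T2Space P] [SigmaCompactSpace P] [LocallyCompactSpace P] [CompactSpace bM.carrier]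

namespace BoundaryGluingData

/-! ### §1 Seam height functions constant off a compact set -/

omit [IsManifold (𝓡∂ (n + 1)) ∞ M] [IsManifold (𝓡∂ (n + 1)) ∞ N] [IsManifold (𝓡 (n + 1)) ∞ P]
  [T2Space P] [SigmaCompactSpace P] [LocallyCompactSpace P] in
/-- The seam is compact when `∂M` is. [folklore] -/
theorem isCompact_seam_of_compactSpace_carrier : IsCompact G.seam :=
  isCompact_range (G.continuous_jA.comp bM.continuous_incl)

/-- **Seam height functions constant off a compact set.**  For a gluing datum on a Hausdorff,
σ-compact, locally compact `P` with compact seam there is a `C^∞` function `f : P → ℝ`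
vanishing on the seam, positive on `jA (Int M)`, negative on `jB (Int N)`, with nonzero
differential at every seam point, and equal to `1` or `-1` off a compact set.  Construction as in
`exists_seamFunction` (glue by a smooth partition of unity the constants `±1` on the two open
strata and the height coordinates of flat charts at the seam points), except that the flat
chart domains are intersected with a relatively compact open neighbourhood `Ω` of the seam:
off `Ω̄` only the constants contribute.  The regularity along the seam is the computation of
`exists_seamFunction` verbatim (`FlatChart.fderiv_transition_apply_zero_pos`).
Bröcker–Jänich (1982), (13.18) Ex. 2; Hirsch (1976), Ch. 6 §2, Ch. 8 §2. [folklore] -/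
theorem exists_seamFunction_offCompact' : ∃ f : P → ℝ, ContMDiff (𝓡 (n + 1)) 𝓘(ℝ, ℝ) ∞ f ∧
    (∀ p ∈ G.seam, f p = 0) ∧ (∀ p ∈ G.jA '' (𝓡∂ (n + 1)).interior M, 0 < f p) ∧
    (∀ p ∈ G.jB '' (𝓡∂ (n + 1)).interior N, f p < 0) ∧
    (∀ z : bM.carrier, mfderiv (𝓡 (n + 1)) 𝓘(ℝ, ℝ) f (G.jA (bM.incl z)) ≠ 0) ∧
    ∃ K : Set P, IsCompact K ∧ ∀ p ∉ K, f p = 1 ∨ f p = -1 := by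
  -- a relatively compact open neighbourhood of the compact seam
  obtain ⟨Ω, hΩo, hsΩ, hΩc⟩ :=
    exists_isOpen_superset_and_isCompact_closure G.isCompact_seam_of_compactSpace_carrier
  -- the open cover and the local functions
  let U : Option (Option bM.carrier) → Set P := fun i =>
    match i with
    | none => G.jA '' (𝓡∂ (n + 1)).interior M
    | some none => G.jB '' (𝓡∂ (n + 1)).interior N
    | some (some z) => (G.flatChart z).chart.source ∩ Ω
  let loc : Option (Option bM.carrier) → P → ℝ := fun i =>
    match i with
    | none => fun _ => 1
    | some none => fun _ => -1
    | some (some z) => fun p => (G.flatChart z).chart p 0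
  have hUo : ∀ i, IsOpen (U i) := by
    rintro (_ | _ | z)
    · exact G.isOpen_image_jA_interior
    · exact G.isOpen_image_jB_interior
    · exact (G.flatChart z).chart.open_source.inter hΩo
  have hUc : (univ : Set P) ⊆ ⋃ i, U i := by
    intro p _
    rw [mem_iUnion]
    rcases G.mem_seam_or p with ⟨z, rfl⟩ | hA | hB
    · exact ⟨some (some z), (G.flatChart z).mem_source, hsΩ (G.jA_incl_mem_seam z)⟩
    · exact ⟨none, hA⟩
    · exact ⟨some none, hB⟩
  obtain ⟨ρ, hρ⟩ := SmoothPartitionOfUnity.exists_isSubordinate (𝓡 (n + 1)) isClosed_univ U hUo hUc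
  have hmemU : ∀ {i p}, ρ i p ≠ 0 → p ∈ U i := fun {i p} h => hρ i (subset_tsupport _ h)
  set f : P → ℝ := fun p => ∑ᶠ i, ρ i p • loc i p with hf_def
  -- smoothness
  have hf : ContMDiff (𝓡 (n + 1)) 𝓘(ℝ, ℝ) ∞ f := by
    refine ρ.contMDiff_finsum_smul fun i p hp => ?_
    rcases i with _ | _ | z
    · exact contMDiffAt_const
    · exact contMDiffAt_const
    · have h1 : ContMDiffAt (𝓡 (n + 1)) 𝓘(ℝ, 𝔼 (n + 1)) ∞ (G.flatChart z).chart p :=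
        (G.flatChart z).contMDiffOn.contMDiffAt
          ((G.flatChart z).chart.open_source.mem_nhds (hρ _ hp).1)
      exact ((EuclideanSpace.proj (0 : Fin (n + 1))).contMDiff.contMDiffAt).comp p h1
  -- values on the three strata
  have hseam : ∀ p ∈ G.seam, f p = 0 := by
    intro p hp
    have := ρ.finsum_smul_mem_convex (mem_univ p) (g := loc) (t := {(0 : ℝ)}) (fun i hi => ?_)
      (convex_singleton _)
    · simpa [hf_def] using this
    · have hpU := hmemU hi
      rcases i with _ | _ | z
      · exact absurd hp (G.not_mem_seam_of_mem_image_interior hpU)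
      · exact absurd hp (G.not_mem_seam_of_mem_image_interior' hpU)
      · exact ((G.flatChart z).eq_zero_iff hpU.1).2 hp
  have hpos : ∀ p ∈ G.jA '' (𝓡∂ (n + 1)).interior M, 0 < f p := by
    intro p hp
    have := ρ.finsum_smul_mem_convex (mem_univ p) (g := loc) (t := Ioi (0 : ℝ)) (fun i hi => ?_)
      (convex_Ioi _)
    · simpa [hf_def] using this
    · have hpU := hmemU hi
      rcases i with _ | _ | z
      · show (0 : ℝ) < 1
        exact zero_lt_one
      · exact absurd (image_subset_range _ _ hpU) (G.not_mem_range_jB_of_mem_image_interior hp)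
      · exact ((G.flatChart z).pos_iff hpU.1).2 hp
  have hneg : ∀ p ∈ G.jB '' (𝓡∂ (n + 1)).interior N, f p < 0 := by
    intro p hp
    have := ρ.finsum_smul_mem_convex (mem_univ p) (g := loc) (t := Iio (0 : ℝ)) (fun i hi => ?_)
      (convex_Iio _)
    · simpa [hf_def] using this
    · have hpU := hmemU hi
      rcases i with _ | _ | z
      · exact absurd (image_subset_range _ _ hpU) (G.not_mem_range_jA_of_mem_image_interior' hp)
      · show (-1 : ℝ) < 0
        norm_num
      · exact ((G.flatChart z).neg_iff hpU.1).2 (G.not_mem_range_jA_of_mem_image_interior' hp)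
  -- values off `Ω̄`: only the constants contribute
  have hoff : ∀ p ∉ closure Ω, f p = 1 ∨ f p = -1 := by
    intro p hpΩ
    rcases G.mem_seam_or p with hs | hA | hB
    · exact absurd (subset_closure (hsΩ hs)) hpΩ
    · left
      have := ρ.finsum_smul_mem_convex (mem_univ p) (g := loc) (t := {(1 : ℝ)}) (fun i hi => ?_)
        (convex_singleton _)
      · simpa [hf_def] using this
      · have hpU := hmemU hi
        rcases i with _ | _ | z
        · rfl
        · exact absurd (image_subset_range _ _ hpU) (G.not_mem_range_jB_of_mem_image_interior hA)
        · exact absurd (subset_closure hpU.2) hpΩ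
    · right
      have := ρ.finsum_smul_mem_convex (mem_univ p) (g := loc) (t := {(-1 : ℝ)}) (fun i hi => ?_)
        (convex_singleton _)
      · simpa [hf_def] using this
      · have hpU := hmemU hi
        rcases i with _ | _ | z
        · exact absurd (image_subset_range _ _ hpU) (G.not_mem_range_jA_of_mem_image_interior' hB)
        · rfl
        · exact absurd (subset_closure hpU.2) hpΩ
  refine ⟨f, hf, hseam, hpos, hneg, fun z₀ => ?_, closure Ω, hΩc, hoff⟩
  -- the differential at the seam point `p = jA (incl z₀)`
  set p := G.jA (bM.incl z₀) with hp_def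
  have hps : p ∈ G.seam := G.jA_incl_mem_seam z₀
  set F₀ := G.flatChart z₀ with hF₀
  set c₀ := F₀.chart p with hc₀
  have hp₀ : p ∈ F₀.chart.source := F₀.mem_source
  -- finitely many indices are active near `p`
  obtain ⟨I, hI⟩ := ρ.toPartitionOfUnity.exists_finset_nhds p
  have hfI : ∀ᶠ x in 𝓝 p, f x = ∑ i ∈ I, ρ i x * loc i x := by
    filter_upwards [hI] with x hx
    rw [hf_def]
    exact finsum_eq_sum_of_support_subset _
      ((support_smul_subset_left (fun i => ρ i x) fun i => loc i x).trans hx.2)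
  -- the normal curve of the flat chart `F₀`
  set γ : ℝ → P := fun t => F₀.chart.symm (c₀ + t • upNormal n) with hγ
  have hγ0 : γ 0 = p := by simp [hγ, hc₀, F₀.chart.left_inv hp₀]
  have hline : Continuous fun t : ℝ => c₀ + t • upNormal n := by fun_prop
  have htn : F₀.chart.target ∈ 𝓝 c₀ := F₀.chart.open_target.mem_nhds (F₀.chart.map_source hp₀)
  have hγc : ContinuousAt γ 0 := by
    refine ContinuousAt.comp (g := F₀.chart.symm) ?_ hline.continuousAt
    simpa using F₀.chart.continuousOn_symm.continuousAt htn
  have hγt : Tendsto γ (𝓝 0) (𝓝 p) := by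
    have := hγc.tendsto
    rwa [hγ0] at this
  -- derivative of each summand along the curve
  let e : Option (Option bM.carrier) → ℝ := fun i =>
    match i with
    | some (some z) => fderiv ℝ ((G.flatChart z).chart ∘ F₀.chart.symm) c₀ (upNormal n) 0
    | _ => 0
  have hsummand : ∀ i, HasDerivAt (fun t => ρ i (γ t) * loc i (γ t)) (ρ i p * e i) 0 := by
    intro i
    by_cases hi : p ∈ tsupport (ρ i)
    · have hpU : p ∈ U i := hρ i hi
      rcases i with _ | _ | z
      · exact absurd hps (G.not_mem_seam_of_mem_image_interior hpU)
      · exact absurd hps (G.not_mem_seam_of_mem_image_interior' hpU)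
      · -- a flat chart through `p`: product rule, the chart term via the transition map
        set F := G.flatChart z with hF
        have hpF : p ∈ F.chart.source := hpU.1
        set O : Set (𝔼 (n + 1)) := F₀.chart.target ∩ F₀.chart.symm ⁻¹' F.chart.source with hO
        have hOo : IsOpen O := F₀.chart.symm.isOpen_inter_preimage F.chart.open_source
        have hcO : c₀ ∈ O := ⟨F₀.chart.map_source hp₀, by
          rw [mem_preimage, hc₀, F₀.chart.left_inv hp₀]; exact hpF⟩
        have hOn : O ∈ 𝓝 c₀ := hOo.mem_nhds hcO
        -- the weight along the curve
        have hρd : ContDiffOn ℝ ∞ (ρ (some (some z)) ∘ F₀.chart.symm) F₀.chart.target :=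
          contMDiffOn_iff_contDiffOn.1
            ((ρ (some (some z))).contMDiff.comp_contMDiffOn F₀.contMDiffOn_symm)
        have hρa : HasFDerivAt (ρ (some (some z)) ∘ F₀.chart.symm)
            (fderiv ℝ (ρ (some (some z)) ∘ F₀.chart.symm) c₀) c₀ :=
          ((hρd.differentiableOn (by simp)).differentiableAt htn).hasFDerivAt
        have hρline : HasDerivAt (fun t : ℝ => ρ (some (some z)) (γ t))
            (fderiv ℝ (ρ (some (some z)) ∘ F₀.chart.symm) c₀ (upNormal n)) 0 := by
          have hl : HasDerivAt (fun t : ℝ => c₀ + t • upNormal n) (upNormal n) 0 := by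
            simpa using ((hasDerivAt_id (0 : ℝ)).smul_const (upNormal n)).const_add c₀
          exact hρa.comp_hasDerivAt_of_eq (x := (0 : ℝ)) hl (by simp)
        -- the height coordinate along the curve
        have hτ : ContDiffOn ℝ ∞ (F.chart ∘ F₀.chart.symm) O := by
          have := F.contMDiffOn.comp (F₀.contMDiffOn_symm.mono inter_subset_left) fun u hu => hu.2
          exact contMDiffOn_iff_contDiffOn.1 this
        have hτa : HasFDerivAt (F.chart ∘ F₀.chart.symm)
            (fderiv ℝ (F.chart ∘ F₀.chart.symm) c₀) c₀ :=
          ((hτ.differentiableOn (by simp)).differentiableAt hOn).hasFDerivAt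
        have hlocline : HasDerivAt (fun t : ℝ => loc (some (some z)) (γ t)) (e (some (some z))) 0 :=
          hasDerivAt_apply_zero_comp_line hτa (upNormal n)
        have hloc0 : loc (some (some z)) (γ 0) = 0 := by
          rw [hγ0]; exact (F.eq_zero_iff hpF).2 hps
        have := hρline.mul hlocline
        rw [hloc0, mul_zero, zero_add, hγ0] at this
        exact this
    · -- an index whose weight vanishes near `p`
      have hzero : (ρ i : P → ℝ) =ᶠ[𝓝 p] 0 := notMem_tsupport_iff_eventuallyEq.1 hi
      have hρp : ρ i p = 0 := hzero.self_of_nhds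
      have hev : (fun t => ρ i (γ t) * loc i (γ t)) =ᶠ[𝓝 0] fun _ => 0 := by
        filter_upwards [hγt.eventually hzero] with t ht
        simp only [Pi.zero_apply] at ht
        simp [ht]
      rw [hρp, zero_mul]
      exact (hasDerivAt_const (0 : ℝ) (0 : ℝ)).congr_of_eventuallyEq hev
  -- the derivative of `f` along the curve is positive
  have hsum : HasDerivAt (fun t => ∑ i ∈ I, ρ i (γ t) * loc i (γ t)) (∑ i ∈ I, ρ i p * e i) 0 :=
    HasDerivAt.fun_sum fun i _ => hsummand i
  have hderiv : HasDerivAt (f ∘ γ) (∑ i ∈ I, ρ i p * e i) 0 := by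
    refine hsum.congr_of_eventuallyEq ?_
    filter_upwards [hγt.eventually hfI] with t ht
    exact ht
  have hSpos : 0 < ∑ i ∈ I, ρ i p * e i := by
    have he : ∀ i, ρ i p ≠ 0 → 0 < e i := by
      intro i hi
      have hpU : p ∈ U i := hmemU hi
      rcases i with _ | _ | z
      · exact absurd hps (G.not_mem_seam_of_mem_image_interior hpU)
      · exact absurd hps (G.not_mem_seam_of_mem_image_interior' hpU)
      · exact F₀.fderiv_transition_apply_zero_pos G (G.flatChart z) hp₀ hpU.1 hps
    refine Finset.sum_pos' (fun i _ => ?_) ?_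
    · by_cases hi : ρ i p = 0
      · rw [hi, zero_mul]
      · exact (mul_pos ((ρ.nonneg i p).lt_of_ne (Ne.symm hi)) (he i hi)).le
    · have h1 : ∑ i ∈ I, ρ i p = 1 := (hI.self_of_nhds).1
      obtain ⟨i, hiI, hi⟩ := Finset.exists_ne_zero_of_sum_ne_zero (h1.symm ▸ one_ne_zero)
      exact ⟨i, hiI, mul_pos ((ρ.nonneg i p).lt_of_ne (Ne.symm hi)) (he i hi)⟩
  -- hence the differential of `f` at `p` is nonzero
  intro h0
  have h0' : mfderiv (𝓡 (n + 1)) 𝓘(ℝ, ℝ) f (γ 0) = 0 := by rw [hγ0]; exact h0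
  have hfm : HasMFDerivAt (𝓡 (n + 1)) 𝓘(ℝ, ℝ) f (γ 0) (mfderiv (𝓡 (n + 1)) 𝓘(ℝ, ℝ) f (γ 0)) :=
    (hf.mdifferentiableAt (by simp)).hasMFDerivAt
  have hγm : MDifferentiableAt 𝓘(ℝ, ℝ) (𝓡 (n + 1)) γ 0 := by
    have h1 : ContMDiffAt 𝓘(ℝ, 𝔼 (n + 1)) (𝓡 (n + 1)) ∞ F₀.chart.symm c₀ :=
      F₀.contMDiffOn_symm.contMDiffAt htn
    have hlc : ContDiff ℝ ∞ fun t : ℝ => c₀ + t • upNormal n := by fun_prop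
    have h2 : ContMDiffAt 𝓘(ℝ, ℝ) 𝓘(ℝ, 𝔼 (n + 1)) ∞ (fun t : ℝ => c₀ + t • upNormal n) 0 :=
      contMDiffAt_iff_contDiffAt.2 hlc.contDiffAt
    have h3 := h1.comp_of_eq h2 (by simp)
    exact h3.mdifferentiableAt (by simp)
  have hcomp := hfm.comp 0 hγm.hasMFDerivAt
  rw [h0', ContinuousLinearMap.zero_comp] at hcomp
  have h4 : HasDerivAt (f ∘ γ) 0 0 := by
    have h5 : HasFDerivAt (f ∘ γ) (0 : ℝ →L[ℝ] ℝ) 0 := hasMFDerivAt_iff_hasFDerivAt.1 hcomp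
    simpa using h5.hasDerivAt
  exact hSpos.ne' (hderiv.unique h4)

/-- **Seam height functions constant off a compact set: the strata as sign sets.**  `f = 0`
exactly on the seam, `f > 0` exactly on `jA (Int M)`, `f < 0` exactly on `jB (Int N)`, `f ≥ 0`
exactly on `range jA`, `f ≤ 0` exactly on `range jB`, `0` is a regular value, and `|f| = 1` off
a compact set. [folklore] -/
theorem exists_seamFunction_offCompact : ∃ f : P → ℝ, ContMDiff (𝓡 (n + 1)) 𝓘(ℝ, ℝ) ∞ f ∧
    (∀ p, f p = 0 ↔ p ∈ G.seam) ∧ (∀ p, 0 < f p ↔ p ∈ G.jA '' (𝓡∂ (n + 1)).interior M) ∧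
    (∀ p, f p < 0 ↔ p ∈ G.jB '' (𝓡∂ (n + 1)).interior N) ∧
    (∀ p, 0 ≤ f p ↔ p ∈ range G.jA) ∧ (∀ p, f p ≤ 0 ↔ p ∈ range G.jB) ∧
    (∀ p, f p = 0 → mfderiv (𝓡 (n + 1)) 𝓘(ℝ, ℝ) f p ≠ 0) ∧
    ∃ K : Set P, IsCompact K ∧ ∀ p ∉ K, f p = 1 ∨ f p = -1 := by
  obtain ⟨f, hf, hseam, hpos, hneg, hreg, K, hK, hoff⟩ := G.exists_seamFunction_offCompact'
  have key : ∀ p, (f p = 0 ↔ p ∈ G.seam) ∧ (0 < f p ↔ p ∈ G.jA '' (𝓡∂ (n + 1)).interior M) ∧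
      (f p < 0 ↔ p ∈ G.jB '' (𝓡∂ (n + 1)).interior N) := by
    intro p
    rcases G.mem_seam_or p with hs | hA | hB
    · have h := hseam p hs
      refine ⟨⟨fun _ => hs, fun _ => h⟩, ⟨fun h' => ?_, fun h' => ?_⟩, ⟨fun h' => ?_, fun h' => ?_⟩⟩
      · rw [h] at h'; exact absurd h' (lt_irrefl 0)
      · exact absurd hs (G.not_mem_seam_of_mem_image_interior h')
      · rw [h] at h'; exact absurd h' (lt_irrefl 0)
      · exact absurd hs (G.not_mem_seam_of_mem_image_interior' h')
    · have h := hpos p hA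
      refine ⟨⟨fun h' => ?_, fun h' => ?_⟩, ⟨fun _ => hA, fun _ => h⟩, ⟨fun h' => ?_, fun h' => ?_⟩⟩
      · rw [h'] at h; exact absurd h (lt_irrefl 0)
      · exact absurd h' (G.not_mem_seam_of_mem_image_interior hA)
      · exact absurd (h.trans h') (lt_irrefl 0)
      · exact absurd (image_subset_range _ _ h') (G.not_mem_range_jB_of_mem_image_interior hA)
    · have h := hneg p hB
      refine ⟨⟨fun h' => ?_, fun h' => ?_⟩, ⟨fun h' => ?_, fun h' => ?_⟩, ⟨fun _ => hB, fun _ => h⟩⟩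
      · rw [h'] at h; exact absurd h (lt_irrefl 0)
      · exact absurd h' (G.not_mem_seam_of_mem_image_interior' hB)
      · exact absurd (h'.trans h) (lt_irrefl 0)
      · exact absurd (image_subset_range _ _ hB) (G.not_mem_range_jB_of_mem_image_interior h')
  refine ⟨f, hf, fun p => (key p).1, fun p => (key p).2.1, fun p => (key p).2.2, fun p => ?_,
    fun p => ?_, fun p hp => ?_, K, hK, hoff⟩
  · rw [le_iff_lt_or_eq, (key p).2.1, eq_comm, (key p).1]
    constructor
    · rintro (h | h)
      · exact image_subset_range _ _ h
      · exact G.seam_subset_range_jA h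
    · rintro ⟨a, rfl⟩
      by_cases ha : a ∈ (𝓡∂ (n + 1)).interior M
      · exact Or.inl ⟨a, ha, rfl⟩
      · right
        rw [G.jA_mem_seam_iff, bM.range_incl, ← ModelWithCorners.compl_interior]
        exact ha
  · rw [le_iff_lt_or_eq, (key p).2.2, (key p).1]
    constructor
    · rintro (h | h)
      · exact image_subset_range _ _ h
      · exact G.seam_subset_range_jB h
    · rintro ⟨b, rfl⟩
      by_cases hb : b ∈ (𝓡∂ (n + 1)).interior N
      · exact Or.inl ⟨b, hb, rfl⟩
      · right
        rw [← G.symm_seam]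
        refine (G.symm.jA_mem_seam_iff b).2 ?_
        rw [bN.range_incl, ← ModelWithCorners.compl_interior]
        exact hb
  · obtain ⟨z, rfl⟩ := ((key p).1).1 hp
    exact hreg z

/-! ### §2 A compact band of regular points about the seam -/

omit [IsManifold (𝓡∂ (n + 1)) ∞ M] [IsManifold (𝓡∂ (n + 1)) ∞ N] [T2Space P] [SigmaCompactSpace P]
  [LocallyCompactSpace P] [CompactSpace bM.carrier] G in
/-- **A compact regular band.** If `f : P → ℝ` is `C^∞`, regular on its zero set, and `|f| = 1`
off a compact set `K`, then for some `δ ∈ (0, 1/2]` the band `f⁻¹[-δ, δ]` is compact and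
contains no critical point of `f` (the critical set is closed, `isClosed_criticalSet_of_contMDiff`,
so the critical points with `|f| ≤ 1/2` form a compact set on which `|f|` has a positive
minimum). [folklore] -/
theorem exists_regular_compact_band {f : P → ℝ} (hf : ContMDiff (𝓡 (n + 1)) 𝓘(ℝ, ℝ) ∞ f)
    (hreg : ∀ p, f p = 0 → mfderiv (𝓡 (n + 1)) 𝓘(ℝ, ℝ) f p ≠ 0)
    {K : Set P} (hK : IsCompact K) (hoff : ∀ p ∉ K, f p = 1 ∨ f p = -1) :
    ∃ δ, 0 < δ ∧ δ ≤ 1 / 2 ∧ IsCompact (f ⁻¹' Icc (-δ) δ) ∧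
      ∀ p, f p ∈ Icc (-δ) δ → mfderiv (𝓡 (n + 1)) 𝓘(ℝ, ℝ) f p ≠ 0 := by
  -- the half band is a closed subset of `K`, hence compact
  have hhalf : ∀ {δ}, 0 < δ → δ ≤ 1 / 2 → f ⁻¹' Icc (-δ) δ ⊆ K := by
    intro δ hδ hδ2 p hp
    by_contra hpK
    rcases hoff p hpK with h | h
    · have := hp.2; rw [h] at this; linarith
    · have := hp.1; rw [h] at this; linarith
  have hbandc : ∀ {δ}, 0 < δ → δ ≤ 1 / 2 → IsCompact (f ⁻¹' Icc (-δ) δ) := fun hδ hδ2 =>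
    hK.of_isClosed_subset (isClosed_Icc.preimage hf.continuous) (hhalf hδ hδ2)
  -- the compact set of critical points in the half band
  set Z : Set P := criticalSet (𝓡 (n + 1)) f ∩ f ⁻¹' Icc (-(1 / 2)) (1 / 2) with hZ
  have hZc : IsCompact Z :=
    (hbandc (by norm_num) le_rfl).of_isClosed_subset
      ((isClosed_criticalSet_of_contMDiff hf (by norm_cast)).inter
        (isClosed_Icc.preimage hf.continuous)) inter_subset_right
  rcases Z.eq_empty_or_nonempty with hZe | hZne
  · refine ⟨1 / 2, by norm_num, le_rfl, hbandc (by norm_num) le_rfl, fun p hp hcrit => ?_⟩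
    have : p ∈ Z := ⟨hcrit, hp⟩
    rw [hZe] at this
    exact this
  -- `|f|` has a positive minimum on `Z`
  obtain ⟨p₀, hp₀Z, hp₀⟩ := hZc.exists_isMinOn hZne (continuous_abs.comp hf.continuous).continuousOn
  have hpos : 0 < |f p₀| := by
    rw [abs_pos]
    intro h0
    exact hreg p₀ h0 hp₀Z.1
  set δ : ℝ := min (|f p₀| / 2) (1 / 2) with hδ
  have hδpos : 0 < δ := lt_min (half_pos hpos) (by norm_num)
  have hδ2 : δ ≤ 1 / 2 := min_le_right _ _
  refine ⟨δ, hδpos, hδ2, hbandc hδpos hδ2, fun p hp hcrit => ?_⟩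
  have hpZ : p ∈ Z := ⟨hcrit, ⟨by linarith [hp.1], by linarith [hp.2]⟩⟩
  have hmin : |f p₀| ≤ |f p| := hp₀ hpZ
  have habs : |f p| ≤ δ := abs_le.2 ⟨hp.1, hp.2⟩
  linarith [min_le_left (|f p₀| / 2) (1 / 2)]

/-! ### §3 Seam tubes -/

variable [Nonempty bM.carrier]

/-- **Seam tubes exist for gluings with compact seam** on a Hausdorff, σ-compact, locally
compact `P`.  Let `f` be a seam height function constant off a compact set
(`exists_seamFunction_offCompact`), `f⁻¹[-δ, δ]` a compact regular band
(`exists_regular_compact_band`), `ξ` a smooth vector field with `ξ(f) = 1` on the band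
(`exists_contMDiffSection_mlineDeriv_eq_one_on`), cut off by a smooth bump `χ = 1` on the band
with compact support, so that `χ ξ` is complete
(`Literature.Geometry.Manifold.exists_contMDiff_globalFlow_of_eq_zero_off_isCompact`) with
global flow `θ`.  The tube is `K (x, t) = θ (t, jA (incl x))` with inverse
`p ↦ (σ (θ (-f p, p)), f p)`: along flow lines `f` moves at unit speed inside the band, so
`f (K (x, t)) = t` for `|t| < δ` and `θ (-f p, p)` lies on the seam for `|f p| < δ` — the
argument of `nonempty_seamTube` verbatim.  Milnor (1965), proof of Thm. 3.4; Hirsch (1976),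
Ch. 8 §1, proof of Thm. 1.9. [cite: HirschDT1976, Ch. 8 §1, proof of Thm. 1.9] -/
theorem nonempty_seamTube_of_sigmaCompact : Nonempty G.SeamTube := by
  -- a seam height function constant off a compact set, and a compact regular band
  obtain ⟨f, hf, hf0, hfpos, hfneg, -, -, hreg, Kc, hKc, hoff⟩ := G.exists_seamFunction_offCompact
  obtain ⟨δ, hδ, -, hband, hregband⟩ := exists_regular_compact_band hf hreg hKc hoff
  -- a unit-speed field on the band
  have hC : IsClosed (f ⁻¹' Icc (-δ) δ) := isClosed_Icc.preimage hf.continuous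
  obtain ⟨ξ, hξ⟩ := exists_contMDiffSection_mlineDeriv_eq_one_on (I := 𝓡 (n + 1)) hf hC
    fun x hx => hregband x hx
  -- cut off to compact support
  obtain ⟨O, hOo, hCO, hOc⟩ := exists_isOpen_superset_and_isCompact_closure hband
  obtain ⟨χ, hχ0, hχ1, -⟩ := exists_contMDiffMap_zero_one_of_isClosed (𝓡 (n + 1)) (n := ⊤)
    hOo.isClosed_compl hC (disjoint_compl_left_iff_subset.2 hCO)
  let ξ' : Cₛ^∞⟮𝓡 (n + 1); 𝔼 (n + 1), (TangentSpace (𝓡 (n + 1)) : P → Type _)⟯ :=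
    ⟨fun x => χ x • ξ x, χ.contMDiff.smul_section ξ.contMDiff⟩
  have hξ'off : ∀ x, x ∉ closure O → ξ' x = 0 := by
    intro x hx
    have hxO : x ∈ Oᶜ := fun h => hx (subset_closure h)
    change χ x • ξ x = 0
    rw [show χ x = 0 from hχ0 hxO, zero_smul]
  have hξ'band : ∀ x, f x ∈ Icc (-δ) δ → mlineDeriv (𝓡 (n + 1)) f x (ξ' x) = 1 := by
    intro x hx
    change mlineDeriv (𝓡 (n + 1)) f x (χ x • ξ x) = 1
    rw [mlineDeriv_smul, show χ x = 1 from hχ1 hx, one_mul, hξ x hx]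
  -- the global flow of the cut-off field
  obtain ⟨θ, hθ, hθ0, hθadd, hθint, -⟩ :=
    Literature.Geometry.Manifold.exists_contMDiff_globalFlow_of_eq_zero_off_isCompact
      (I := 𝓡 (n + 1)) (M := P) (V := fun x => ξ' x) (n := ⊤) ξ'.contMDiff le_top hOc hξ'off
  -- unit speed of `f` along the flow lines inside the band
  have hderiv : ∀ p t, HasDerivAt (fun s => f (θ (s, p)))
      (mlineDeriv (𝓡 (n + 1)) f (θ (t, p)) (ξ' (θ (t, p)))) t :=
    fun p t => hasDerivAt_comp_integralCurve hf (hθint p) t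
  have hbandξ : ∀ p t, (fun s => f (θ (s, p))) t ∈ Ioo (-δ) δ →
      mlineDeriv (𝓡 (n + 1)) f (θ (t, p)) (ξ' (θ (t, p))) = 1 :=
    fun p t ht => hξ'band _ ⟨by linarith [ht.1], by linarith [ht.2]⟩
  have hfwd : ∀ p, f p ∈ Ioo (-δ) δ → ∀ s, 0 ≤ s → f p + s < δ → f (θ (s, p)) = f p + s := by
    intro p hp s hs hlt
    have key := UnitSpeed.eq_add_of_deriv_eq_one (hderiv p) (hbandξ p) (t₀ := 0) (T := s)
      (by simpa [hθ0] using hp.1) (by simpa [hθ0] using hlt) s ⟨hs, le_rfl⟩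
    simpa [hθ0] using key
  have hbwd : ∀ p, f p ∈ Ioo (-δ) δ → ∀ s, 0 ≤ s → -δ < f p - s → f (θ (-s, p)) = f p - s := by
    intro p hp s hs hlt
    have hd := fun u => UnitSpeed.hasDerivAt_neg_comp_sub (hderiv p) 0 u
    have hb := UnitSpeed.band_neg_comp_sub (g := fun s => f (θ (s, p))) (hbandξ p) 0
    have key := UnitSpeed.eq_add_of_deriv_eq_one hd hb (t₀ := 0) (T := s)
      (by simpa [hθ0] using hp.2) (by simp only [sub_zero, hθ0]; linarith) s ⟨hs, le_rfl⟩
    simp only [zero_add, zero_sub, sub_zero, hθ0] at key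
    linarith
  -- the height along the flow from a seam point, and the retraction onto the seam
  have hseam0 : ∀ x, f (G.seamMap x) = 0 := fun x => (hf0 _).2 (G.jA_incl_mem_seam x)
  have hflow : ∀ x, ∀ t ∈ Ioo (-δ) δ, f (θ (t, G.seamMap x)) = t := by
    intro x t ht
    have h0 : f (G.seamMap x) ∈ Ioo (-δ) δ := by rw [hseam0]; exact ⟨by linarith, hδ⟩
    rcases le_or_gt 0 t with ht0 | ht0
    · have := hfwd _ h0 t ht0 (by rw [hseam0]; linarith [ht.2])
      rwa [hseam0, zero_add] at this
    · have := hbwd _ h0 (-t) (by linarith) (by rw [hseam0]; linarith [ht.1])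
      rw [neg_neg] at this
      rw [this, hseam0]; ring
  have hret : ∀ p, f p ∈ Ioo (-δ) δ → f (θ (-f p, p)) = 0 := by
    intro p hp
    rcases le_or_gt 0 (f p) with h0 | h0
    · have := hbwd p hp (f p) h0 (by linarith [hp.2])
      rwa [sub_self] at this
    · have := hfwd p hp (-f p) (by linarith) (by linarith [hp.1])
      rwa [add_neg_cancel] at this
  have hretseam : ∀ p, f p ∈ Ioo (-δ) δ → θ (-f p, p) ∈ G.seam := fun p hp =>
    (hf0 _).1 (hret p hp)
  -- the tube map and its inverse
  set K : bM.carrier × ℝ → P := fun q => θ (q.2, G.seamMap q.1) with hK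
  set Kinv : P → bM.carrier × ℝ := fun p => (G.seamInv (θ (-f p, p)), f p) with hKinv
  have hθ' : ContMDiff (𝓘(ℝ, ℝ).prod (𝓡 (n + 1))) (𝓡 (n + 1)) ∞ θ := hθ
  have hKsm : ContMDiff ((𝓡 n).prod 𝓘(ℝ, ℝ)) (𝓡 (n + 1)) ∞ K :=
    hθ'.comp (contMDiff_snd.prodMk (G.contMDiff_seamMap.comp contMDiff_fst))
  have hr : ContMDiff (𝓡 (n + 1)) (𝓡 (n + 1)) ∞ fun p => θ (-f p, p) :=
    hθ'.comp ((contDiff_neg.comp_contMDiff hf).prodMk contMDiff_id)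
  refine ⟨{ toFun := K
            invFun := Kinv
            height := f
            ε := δ
            ε_pos := hδ
            contMDiff_toFun := hKsm
            contMDiff_height := hf
            contMDiffOn_invFun := ?_
            toFun_zero := fun x => by simp [hK, hθ0]
            height_toFun := hflow
            invFun_toFun := ?_
            toFun_invFun := ?_
            invFun_snd := fun p => rfl
            height_eq_zero_iff := hf0
            height_pos_iff := hfpos
            height_neg_iff := hfneg }⟩
  · -- smoothness of the inverse on the tube
    intro p hp
    refine ContMDiffWithinAt.prodMk ?_ (hf p).contMDiffWithinAt
    exact G.contMDiffWithinAt_seamInv_comp (hr p).contMDiffWithinAt (fun q hq => hretseam q hq)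
      (hretseam p hp)
  · -- left inverse
    intro x t ht
    simp only [hK, hKinv, hflow x t ht, hθadd, neg_add_cancel, hθ0, seamInv_seamMap]
  · -- right inverse
    intro p hp
    simp only [hK, hKinv]
    rw [G.seamMap_seamInv (hretseam p hp), hθadd, add_neg_cancel, hθ0]

end BoundaryGluingData

end Literature.Topology.FourManifolds

end
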